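import Mathlib
import Literature.NumberTheory.LFunctions.Zhang2022.Section15U009TailBounds
import Literature.NumberTheory.LFunctions.Zhang2022.Section14Eq143Core
import Literature.NumberTheory.LFunctions.Zhang2022.Section3Prop21
import HarnessLib

/-!
# Zhang (2022) §15 u009 (p. 80, tex L4037), first half: the estimate on the critical line —
# `Σ_{ψ∈Ψ₂} |Σ_{m≤P²} k̃(m)ψ̄(m)m^{−(1−s)}|·|B(s,ψ)| ≪ 𝔓𝓛⁻¹⁹` on `σ = 1/2`

Topic `Literature/NumberTheory/LFunctions/Zhang2022` (Landau–Siegel audit tree; verdict-neutral).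
Y. Zhang, *Discrete mean estimates and the Landau–Siegel zero*, arXiv:2211.02515v1 (2022)
[Zhang2022LandauSiegel] — **an unrefereed manuscript under adjudication; nothing here asserts or
denies its Theorems 1–2.** ZHANG-L discharge lane (helper under leaf `Typed.Section15A.Eq15_6`, node
`Z22:§15.u009`, via the tree edge `eq15_4_of`); THEOREM-ONLY.

§15 p. 80 (tex L4037): "In a way similar to the proof of (7.3), the sum over `ψ ∈ Ψ₁` can be extended to
the sum over `ψ ∈ Ψ`". This file is the §15 mirror image of the tree's `Typed.Sec14.Eq143.core` (the
display proving (7.5)): GIVEN Proposition 2.1 and Lemma 3.3 (ii), on `Re s = 1/2`,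
`Σ_{ψ∈Ψ₂} |Σ_{m≤⌊P²⌋} k̃(m)ψ̄(m)m^{−(1−s)}|·|B(s,ψ)| ≤ K𝔓𝓛⁻¹⁹`, by `X⁴ ≤ U²V·#Ψ₂` (`Eq143.pow_four_le`)
with `U = Σ_Ψ|head|² ≪ P²𝓛¹⁴⁴` (`|k̃| ≤ τ₄`, large sieve + `Σ τ₄²/m ≪ (log)¹⁶`, after complex
conjugation), `V = Σ_Ψ|B|⁴ = Σ_Ψ|B²|² ≪ P²𝓛¹⁴⁴` (`B²` is a Dirichlet polynomial of length `≤ P²` with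
coefficients `≪ τ₂ ⋆ τ₂ = τ₄`, `Section7Eq75.sq_dirPoly_eq`), `#Ψ₂ ≪ 𝔓𝓛⁻⁷³⁹` (Prop. 2.1), and
`P² ≤ 2𝔓𝓛⁷⁷`: `X⁴ ≪ 𝔓⁴𝓛^{3·221−739} = 𝔓⁴𝓛⁻⁷⁶`.

## References

* Y. Zhang, arXiv:2211.02515v1 (2022), §15 p. 80, tex L4037; §7 (7.5) p. 35, tex L1900–L1911;
  §3 Lemma 3.3, Prop. 2.1. [cite: Zhang2022LandauSiegel, §15 p. 80]
-/

noncomputable section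

open Finset Complex Real
open scoped ComplexConjugate

namespace Literature.NumberTheory.LFunctions.Zhang2022.Typed.Section15A.U009

open Skeleton MeanSquareMajorant Section7Eq75 Typed.Sec14.Eq143

variable (c' : ℝ) {D : ℕ}

/-! ### A generic second moment with a `τ_j`-majorant -/

/-- **`Σ_{ψ∈Ψ}|Σ_{m≤P²} c(m)ψ(m)m^{−s}|² ≤ C₃₃P²·K²·majorantConst(j²,2j)·(2𝓛⁹)^{j²}`** on `Re s = ½` for
`|c| ≤ Kτ_j`: Lemma 3.3 (ii) and `Σ_{m≤X}τ_j(m)²/m ≤ majorantConst(j²,2j)(log X)^{j²}`, `log⌊P²⌋ ≤ 2𝓛⁹`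
(the `τ_j`-version of the tree's `Eq143.sum_sq_kappaPoly_le`). [cite: Zhang2022LandauSiegel, §7 (7.5) p. 35] -/
theorem sum_sq_le_of_le_tau {D : ℕ} [Fintype (Chr D)] (hℓ : 1 ≤ ell D) {C₃₃ : ℝ}
    (h33 : ∀ (s : ℂ) (c : ℕ → ℂ),
      ∑ᶠ x : Chr D, ‖∑ n ∈ Icc 1 ⌊bigP D ^ 2⌋₊, c n * x.ψ (n : ZMod x.p) * (n : ℂ) ^ (-s)‖ ^ 2
        ≤ C₃₃ * bigP D ^ 2 * ∑ n ∈ Icc 1 ⌊bigP D ^ 2⌋₊, ‖c n‖ ^ 2 * (n : ℝ) ^ (-2 * s.re))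
    (j : ℕ) {K : ℝ} {c : ℕ → ℂ} (hc : ∀ n, ‖c n‖ ≤ K * tau j n) {s : ℂ} (hs : s.re = 1 / 2) :
    ∑ x : Chr D, ‖∑ m ∈ Icc 1 ⌊bigP D ^ 2⌋₊, c m * x.ψ (m : ZMod x.p) * (m : ℂ) ^ (-s)‖ ^ 2 ≤
      max C₃₃ 0 * bigP D ^ 2 * (K ^ 2 * (majorantConst (j ^ 2) (2 * j) * (2 * ell D ^ 9) ^ (j ^ 2))) := by
  obtain ⟨hX, hlog⟩ := floor_bigP_sq_facts hℓ
  set X : ℕ := ⌊bigP D ^ 2⌋₊ with hXdef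
  have key := h33 s c
  rw [finsum_eq_sum_of_fintype, hs] at key
  have hW : ∑ n ∈ Icc 1 X, ‖c n‖ ^ 2 * (n : ℝ) ^ (-2 * (1 / 2 : ℝ)) = ∑ n ∈ Icc 1 X, ‖c n‖ ^ 2 / n := by
    refine sum_congr rfl fun n _ => ?_
    rw [show -2 * (1 / 2 : ℝ) = -1 by norm_num, Real.rpow_neg_one, div_eq_mul_inv]
  rw [hW] at key
  have hτ := sum_tau_sq_div_le j hX
  have hW1 : ∑ n ∈ Icc 1 X, ‖c n‖ ^ 2 / n ≤ K ^ 2 * ∑ n ∈ Icc 1 X, tau j n ^ 2 / n := by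
    rw [mul_sum]
    refine sum_le_sum fun n _ => ?_
    have h2 : ‖c n‖ ^ 2 ≤ (K * tau j n) ^ 2 := pow_le_pow_left₀ (norm_nonneg _) (hc n) 2
    rw [mul_div_assoc', ← mul_pow]
    exact div_le_div_of_nonneg_right h2 (Nat.cast_nonneg n)
  have hM := majorantConst_pos (j ^ 2) (2 * j)
  have hlog0 : 0 ≤ Real.log (X : ℝ) := Real.log_natCast_nonneg X
  have hW2 : ∑ n ∈ Icc 1 X, tau j n ^ 2 / n ≤ majorantConst (j ^ 2) (2 * j) * (2 * ell D ^ 9) ^ (j ^ 2) :=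
    hτ.trans (mul_le_mul_of_nonneg_left (pow_le_pow_left₀ hlog0 hlog (j ^ 2)) hM.le)
  have hP : 0 ≤ bigP D ^ 2 := sq_nonneg _
  calc ∑ x : Chr D, ‖∑ m ∈ Icc 1 X, c m * x.ψ (m : ZMod x.p) * (m : ℂ) ^ (-s)‖ ^ 2
      ≤ C₃₃ * bigP D ^ 2 * ∑ n ∈ Icc 1 X, ‖c n‖ ^ 2 / n := key
    _ ≤ max C₃₃ 0 * bigP D ^ 2 * ∑ n ∈ Icc 1 X, ‖c n‖ ^ 2 / n := by
        have hW0 : 0 ≤ ∑ n ∈ Icc 1 X, ‖c n‖ ^ 2 / n := sum_nonneg fun n _ => by positivity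
        exact mul_le_mul_of_nonneg_right (mul_le_mul_of_nonneg_right (le_max_left _ _) hP) hW0
    _ ≤ max C₃₃ 0 * bigP D ^ 2 * (K ^ 2 * (majorantConst (j ^ 2) (2 * j) * (2 * ell D ^ 9) ^ (j ^ 2))) := by
        refine mul_le_mul_of_nonneg_left (hW1.trans ?_) (mul_nonneg (le_max_right _ _) hP)
        exact mul_le_mul_of_nonneg_left hW2 (sq_nonneg _)

/-! ### The second moment of the head (after complex conjugation) -/

/-- **`U = Σ_{ψ∈Ψ}|Σ_{m≤⌊P²⌋} k̃(m)ψ̄(m)m^{−(1−s)}|² ≤ C₃₃P²·majorantConst 16 8·(2𝓛⁹)¹⁶`** on `Re s = ½`: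
conjugating, `|Σ k̃ψ̄(m)m^{−(1−s)}| = |Σ k̃̄(m)ψ(m)m^{−(1−s̄)}|` with `Re(1−s̄) = ½`, and `|k̃| ≤ τ₄`
(`Typed.Section15A.norm_ktilde_le`). [cite: Zhang2022LandauSiegel, §7 (7.5) p. 35; §15 p. 80] -/
theorem sum_sq_head_le {D : ℕ} [Fintype (Chr D)] (hℓ : 1 ≤ ell D) {C₃₃ : ℝ}
    (h33 : ∀ (s : ℂ) (c : ℕ → ℂ),
      ∑ᶠ x : Chr D, ‖∑ n ∈ Icc 1 ⌊bigP D ^ 2⌋₊, c n * x.ψ (n : ZMod x.p) * (n : ℂ) ^ (-s)‖ ^ 2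
        ≤ C₃₃ * bigP D ^ 2 * ∑ n ∈ Icc 1 ⌊bigP D ^ 2⌋₊, ‖c n‖ ^ 2 * (n : ℝ) ^ (-2 * s.re))
    {s : ℂ} (hs : s.re = 1 / 2) :
    ∑ x : Chr D, ‖∑ m ∈ Icc 1 ⌊bigP D ^ 2⌋₊,
        ktilde c' D m * conj (x.ψ (m : ZMod x.p)) * (m : ℂ) ^ (-(1 - s))‖ ^ 2 ≤
      max C₃₃ 0 * bigP D ^ 2 * (1 ^ 2 * (majorantConst (4 ^ 2) (2 * 4) * (2 * ell D ^ 9) ^ (4 ^ 2))) := by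
  have hℓ0 : 0 < ell D := by linarith
  set w : ℂ := conj (1 - s) with hw
  have hwre : w.re = 1 / 2 := by rw [hw, Complex.conj_re, sub_re, one_re, hs]; norm_num
  have hconj : ∀ x : Chr D,
      ‖∑ m ∈ Icc 1 ⌊bigP D ^ 2⌋₊, ktilde c' D m * conj (x.ψ (m : ZMod x.p)) * (m : ℂ) ^ (-(1 - s))‖ =
        ‖∑ m ∈ Icc 1 ⌊bigP D ^ 2⌋₊, conj (ktilde c' D m) * x.ψ (m : ZMod x.p) * (m : ℂ) ^ (-w)‖ := by
    intro x
    rw [← Complex.norm_conj, map_sum]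
    congr 1
    refine sum_congr rfl fun m _ => ?_
    have hk : conj ((m : ℂ) ^ (-(1 - s))) = (m : ℂ) ^ (-w) := by
      rw [hw, ← map_neg, Complex.cpow_conj _ _ (by rw [Complex.natCast_arg]; exact Real.pi_ne_zero.symm),
        Complex.conj_natCast]
    rw [map_mul, map_mul, Complex.conj_conj, hk]
  simp only [hconj]
  refine sum_sq_le_of_le_tau hℓ h33 4 (K := 1) (c := fun m => conj (ktilde c' D m)) (fun m => ?_) hwre
  rw [Complex.norm_conj, one_mul]
  exact norm_ktilde_le c' hℓ0 m

/-! ### The fourth moment of `B(s,ψ)` (its square is a polynomial of length `≤ P²`) -/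

/-- `χψ` is completely multiplicative. [cite: Zhang2022LandauSiegel, §2 (2.23)] -/
private theorem pc_mul' [NeZero D] (χ : DirichletCharacter ℂ D) (x : Chr D) (a b : ℕ) :
    pc χ x (a * b) = pc χ x a * pc χ x b := by
  rw [pc, pc, pc, Nat.cast_mul, Nat.cast_mul, map_mul, map_mul]
  ring

/-- `χψ(0) = 0`. [cite: Zhang2022LandauSiegel, §2 (2.23)] -/
private theorem pc_zero [NeZero D] (χ : DirichletCharacter ℂ D) (x : Chr D) : pc χ x 0 = 0 := by
  rw [pc, Nat.cast_zero, MulChar.map_zero, zero_mul]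

/-- `⌈PT⁻²⌉·⌈PT⁻²⌉ ≤ ⌊P²⌋` (`⌈PT⁻²⌉ ≤ P`, `𝓛 ≥ 2`). [cite: Zhang2022LandauSiegel, §2 (2.6), §6] -/
theorem ceil_PT2_sq_le_floor (hℓ : 2 ≤ ell D) :
    ⌈bigP D / bigT D ^ 2⌉₊ * ⌈bigP D / bigT D ^ 2⌉₊ ≤ ⌊bigP D ^ 2⌋₊ := by
  have hN := ceil_PT2_le_bigP (D := D) hℓ
  have hN0 : (0 : ℝ) ≤ ⌈bigP D / bigT D ^ 2⌉₊ := Nat.cast_nonneg _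
  refine Nat.le_floor ?_
  push_cast
  have h := mul_le_mul hN hN hN0 (le_trans hN0 hN)
  nlinarith

/-- **`V = Σ_{ψ∈Ψ}|B(s,ψ)|⁴ ≤ C₃₃P²·C_b⁴·majorantConst 16 8·(2𝓛⁹)¹⁶`** on `Re s = ½` (`𝓛 ≥ 3`):
`B(s,ψ)² = Σ_{k≤⌊P²⌋}(b′⋆b′)(k)χψ(k)k^{−s}` (`Section7Eq75.sq_dirPoly_eq`, `b′` = `b` truncated at
`⌈PT⁻²⌉`), `|(b′⋆b′)(k)| ≤ C_b²τ₄(k)` (`norm_seqConv_le_tau`), then the large sieve.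
[cite: Zhang2022LandauSiegel, §7 (7.5) p. 35; §15 (15.1)–(15.2) p. 79] -/
theorem sum_pow_four_Bpoly_le {D : ℕ} [NeZero D] [Fintype (Chr D)] (χ : DirichletCharacter ℂ D)
    (hℓ3 : 3 ≤ ell D) {C₃₃ : ℝ}
    (h33 : ∀ (s : ℂ) (c : ℕ → ℂ),
      ∑ᶠ x : Chr D, ‖∑ n ∈ Icc 1 ⌊bigP D ^ 2⌋₊, c n * x.ψ (n : ZMod x.p) * (n : ℂ) ^ (-s)‖ ^ 2
        ≤ C₃₃ * bigP D ^ 2 * ∑ n ∈ Icc 1 ⌊bigP D ^ 2⌋₊, ‖c n‖ ^ 2 * (n : ℝ) ^ (-2 * s.re))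
    {s : ℂ} (hs : s.re = 1 / 2) :
    ∑ x : Chr D, ‖Bpoly χ x s‖ ^ 4 ≤
      max C₃₃ 0 * bigP D ^ 2 *
        ((((1 + ‖iota2‖) * (‖iota3‖ + ‖iota4‖)) ^ 2) ^ 2 *
          (majorantConst (4 ^ 2) (2 * 4) * (2 * ell D ^ 9) ^ (4 ^ 2))) := by
  have hℓ1 : 1 ≤ ell D := by linarith
  have hℓ2 : 2 ≤ Real.log D := by have : ell D = Real.log D := rfl; linarith
  set X : ℕ := ⌊bigP D ^ 2⌋₊ with hXdef
  set N : ℕ := ⌈bigP D / bigT D ^ 2⌉₊ with hNdef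
  set Cb : ℝ := (1 + ‖iota2‖) * (‖iota3‖ + ‖iota4‖) with hCb
  have hCb0 : 0 ≤ Cb := by positivity
  set b' : ℕ → ℂ := fun n => if n < N then bcoef D n else 0 with hb'
  set c₂ : ℕ → ℂ := fun k => seqConv b' b' k * χ (k : ZMod D) with hc₂
  have hNX : (N - 1) * (N - 1) ≤ X :=
    le_trans (Nat.mul_le_mul (Nat.sub_le N 1) (Nat.sub_le N 1)) (ceil_PT2_sq_le_floor (by linarith))
  -- `B(s,ψ)² = Σ_{k≤X} c₂(k)ψ(k)k^{−s}`
  have hsq : ∀ x : Chr D, Bpoly χ x s ^ 2 =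
      ∑ k ∈ Icc 1 X, c₂ k * x.ψ (k : ZMod x.p) * (k : ℂ) ^ (-s) := by
    intro x
    rw [Bpoly_eq_sum_bcoef χ x hℓ3 (N := N) (Nat.le_ceil _) s,
      sq_dirPoly_eq N X hNX (bcoef D) (fun n => pc χ x n) (pc_zero χ x) (pc_mul' χ x) s]
    refine sum_congr rfl fun k _ => ?_
    rw [hc₂, pc]
    ring
  -- the majorant `|c₂| ≤ C_b²τ₄`
  have hb'le : ∀ n, n ≠ 0 → ‖b' n‖ ≤ Cb * tau 2 n := by
    intro n _
    simp only [hb']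
    split_ifs
    · exact norm_bcoef_le hℓ2 n
    · rw [norm_zero]; exact mul_nonneg hCb0 (tau_nonneg 2 n)
  have hc₂le : ∀ k, ‖c₂ k‖ ≤ Cb ^ 2 * tau 4 k := by
    intro k
    rw [hc₂, norm_mul]
    have h1 : ‖seqConv b' b' k‖ ≤ Cb * Cb * tau (2 + 2) k := norm_seqConv_le_tau hCb0 hb'le hb'le k
    calc ‖seqConv b' b' k‖ * ‖χ (k : ZMod D)‖ ≤ (Cb * Cb * tau (2 + 2) k) * 1 :=
          mul_le_mul h1 (DirichletCharacter.norm_le_one _ _) (norm_nonneg _)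
            (mul_nonneg (mul_nonneg hCb0 hCb0) (tau_nonneg _ _))
      _ = Cb ^ 2 * tau 4 k := by ring_nf
  have key := sum_sq_le_of_le_tau hℓ1 h33 4 hc₂le hs
  calc ∑ x : Chr D, ‖Bpoly χ x s‖ ^ 4
      = ∑ x : Chr D, ‖∑ k ∈ Icc 1 X, c₂ k * x.ψ (k : ZMod x.p) * (k : ℂ) ^ (-s)‖ ^ 2 := by
        refine sum_congr rfl fun x _ => ?_
        rw [show (4 : ℕ) = 2 * 2 by norm_num, pow_mul, ← norm_pow, hsq x]
    _ ≤ _ := key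

/-! ### The core bound on the critical line -/

/-- **The §15.u009 mirror of the display proving (7.5)**: GIVEN Proposition 2.1 and Lemma 3.3 (ii), there
is `K` such that for all large `D`, every real primitive `χ (mod D)` with (A), and every `s` with `Re s = ½`:
`Σ_{ψ∈Ψ₂} |Σ_{m≤P²} k̃(m)ψ̄(m)m^{−(1−s)}|·|B(s,ψ)| ≤ K·𝔓·𝓛⁻¹⁹`
(`X⁴ ≤ U²V·#Ψ₂ ≤ (c_UP²𝓛¹⁴⁴)²(c_VP²𝓛¹⁴⁴)(C₂₁𝔓𝓛⁻⁷³⁹)`, `P² ≤ 2𝔓𝓛⁷⁷` ⇒ `X⁴ ≤ c𝔓⁴𝓛⁻⁷⁶`).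
[cite: Zhang2022LandauSiegel, §15 p. 80, tex L4037; §7 (7.5) p. 35] -/
theorem core (h21 : Prop21) (h33b : Lemma33b) (c' : ℝ) :
    ∃ K : ℝ, ForAllLarge fun D _ χ => AssumptionA D χ → ∀ s : ℂ, s.re = 1 / 2 →
      ∑ x ∈ finsetOf (PsiTwo χ),
        ‖∑ m ∈ Icc 1 ⌊bigP D ^ 2⌋₊,
            ktilde c' D m * conj (x.ψ (m : ZMod x.p)) * (m : ℂ) ^ (-(1 - s))‖ * ‖Bpoly χ x s‖ ≤
        K * frakP D * (ell D ^ 19)⁻¹ := by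
  obtain ⟨C₂₁, D₁, hD₁⟩ := h21
  obtain ⟨C₃₃, h33⟩ := h33b
  set Cb : ℝ := (1 + ‖iota2‖) * (‖iota3‖ + ‖iota4‖) with hCb
  set cU : ℝ := max C₃₃ 0 * (1 ^ 2 * (majorantConst (4 ^ 2) (2 * 4) * 2 ^ (4 ^ 2))) with hcU
  set cV : ℝ := max C₃₃ 0 * ((Cb ^ 2) ^ 2 * (majorantConst (4 ^ 2) (2 * 4) * 2 ^ (4 ^ 2))) with hcV
  set c : ℝ := 8 * cU ^ 2 * cV * max C₂₁ 0 with hc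
  have hM := majorantConst_pos (4 ^ 2) (2 * 4)
  have hCb0 : 0 ≤ Cb := by positivity
  have hcU0 : 0 ≤ cU := by positivity
  have hcV0 : 0 ≤ cV := by positivity
  have hc0 : 0 ≤ c := by positivity
  refine ⟨1 + c, ?_⟩
  obtain ⟨D₂, hD₂⟩ := bigP_sq_le
  obtain ⟨D₄, hD₄⟩ := exists_nat_le_ell 3
  refine ⟨max (max D₁ D₂) D₄, fun D _ χ hD hq hp hA s hs => ?_⟩
  simp only [max_le_iff] at hD
  obtain ⟨⟨hD₁', hD₂'⟩, hD₄'⟩ := hD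
  have hℓ3 : 3 ≤ ell D := hD₄ D hD₄'
  have hℓ : 1 ≤ ell D := by linarith
  have hℓ0 : 0 < ell D := by linarith
  haveI : Fintype (Chr D) := Fintype.ofFinite _
  set ℓ : ℝ := ell D with hℓdef
  set Pf : ℝ := frakP D with hPf
  have hPf0 : 0 ≤ Pf := by
    rw [hPf, frakP_eq_sum_primeWindow]; exact sum_nonneg fun p _ => Nat.cast_nonneg p
  have hU := sum_sq_head_le c' hℓ (h33 D) hs
  have hV := sum_pow_four_Bpoly_le χ hℓ3 (h33 D) hs
  have hS : ((finsetOf (PsiTwo χ)).card : ℝ) ≤ max C₂₁ 0 * Pf * (ℓ ^ 739)⁻¹ := by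
    rw [card_finsetOf (Set.toFinite _)]
    refine (hD₁ D χ hD₁' hq hp hA).trans ?_
    exact mul_le_mul_of_nonneg_right (mul_le_mul_of_nonneg_right (le_max_left _ _) hPf0)
      (inv_nonneg.mpr (pow_nonneg hℓ0.le _))
  have hP2 : bigP D ^ 2 ≤ 2 * Pf * ℓ ^ 77 := hD₂ D hD₂'
  have hP20 : 0 ≤ bigP D ^ 2 := sq_nonneg _
  have hpow : (2 * ell D ^ 9) ^ (4 ^ 2) = 2 ^ (4 ^ 2) * ℓ ^ 144 := by rw [hℓdef]; ring
  have hU' : ∑ x : Chr D, ‖∑ m ∈ Icc 1 ⌊bigP D ^ 2⌋₊,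
      ktilde c' D m * conj (x.ψ (m : ZMod x.p)) * (m : ℂ) ^ (-(1 - s))‖ ^ 2 ≤ cU * bigP D ^ 2 * ℓ ^ 144 := by
    refine hU.trans (le_of_eq ?_); rw [hcU, hpow]; ring
  have hV' : ∑ x : Chr D, ‖Bpoly χ x s‖ ^ 4 ≤ cV * bigP D ^ 2 * ℓ ^ 144 := by
    refine hV.trans (le_of_eq ?_); rw [hcV, hpow]; ring
  have hX4 := pow_four_le (finsetOf (PsiTwo χ)) Finset.univ (Finset.subset_univ _)
    (fun x : Chr D => ‖∑ m ∈ Icc 1 ⌊bigP D ^ 2⌋₊,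
      ktilde c' D m * conj (x.ψ (m : ZMod x.p)) * (m : ℂ) ^ (-(1 - s))‖)
    (fun x : Chr D => ‖Bpoly χ x s‖) (fun _ => norm_nonneg _) (fun _ => norm_nonneg _)
  have hUn : 0 ≤ ∑ x : Chr D, ‖∑ m ∈ Icc 1 ⌊bigP D ^ 2⌋₊,
      ktilde c' D m * conj (x.ψ (m : ZMod x.p)) * (m : ℂ) ^ (-(1 - s))‖ ^ 2 :=
    sum_nonneg fun x _ => sq_nonneg _
  have hVn : 0 ≤ ∑ x : Chr D, ‖Bpoly χ x s‖ ^ 4 := sum_nonneg fun x _ => by positivity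
  have h1 := hX4.trans (mul_le_mul (pow_le_pow_left₀ hUn hU' 2) (mul_le_mul hV' hS (Nat.cast_nonneg _)
    (hVn.trans hV')) (mul_nonneg hVn (Nat.cast_nonneg _)) (sq_nonneg _))
  have h2 : (cU * bigP D ^ 2 * ℓ ^ 144) ^ 2 *
      ((cV * bigP D ^ 2 * ℓ ^ 144) * (max C₂₁ 0 * Pf * (ℓ ^ 739)⁻¹)) ≤
      (cU * (2 * Pf * ℓ ^ 77) * ℓ ^ 144) ^ 2 *
        ((cV * (2 * Pf * ℓ ^ 77) * ℓ ^ 144) * (max C₂₁ 0 * Pf * (ℓ ^ 739)⁻¹)) := by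
    have : 0 ≤ (ℓ ^ 739)⁻¹ := inv_nonneg.mpr (pow_nonneg hℓ0.le _)
    gcongr
  have h3 : (cU * (2 * Pf * ℓ ^ 77) * ℓ ^ 144) ^ 2 *
      ((cV * (2 * Pf * ℓ ^ 77) * ℓ ^ 144) * (max C₂₁ 0 * Pf * (ℓ ^ 739)⁻¹)) =
      c * Pf ^ 4 * (ℓ ^ 76)⁻¹ := by
    rw [hc]; field_simp; ring
  have h4 : c * Pf ^ 4 * (ℓ ^ 76)⁻¹ ≤ ((1 + c) * Pf * (ℓ ^ 19)⁻¹) ^ 4 := by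
    have hK : c ≤ (1 + c) ^ 4 :=
      (le_add_of_nonneg_left zero_le_one).trans (le_self_pow₀ (by linarith) (by norm_num))
    calc c * Pf ^ 4 * (ℓ ^ 76)⁻¹ ≤ (1 + c) ^ 4 * Pf ^ 4 * (ℓ ^ 76)⁻¹ := by
          gcongr
      _ = ((1 + c) * Pf * (ℓ ^ 19)⁻¹) ^ 4 := by rw [mul_pow, mul_pow, inv_pow, ← pow_mul]
  have hK0 : 0 ≤ (1 + c) * Pf * (ℓ ^ 19)⁻¹ := by positivity
  exact le_of_pow_le_pow_left₀ (by norm_num) hK0 (h1.trans (h2.trans (h3.le.trans h4)))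

end Literature.NumberTheory.LFunctions.Zhang2022.Typed.Section15A.U009
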